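import Summits.Parity.GeneralizedHardyLittlewood.Theorems.GreenTaoLevelTwoGITwoCyclicInverseAffine
import Summits.Parity.GeneralizedHardyLittlewood.Theorems.GreenTaoLevelTwoGITwoCyclicInverseGraphFibre
import Summits.Parity.GeneralizedHardyLittlewood.Theorems.GreenTaoLevelTwoGITwoCyclicInverseTorusBoxes
import Summits.Parity.GeneralizedHardyLittlewood.Theorems.GreenTaoLevelTwoGITwoCyclicInverseGraphSlice
import Summits.Parity.GeneralizedHardyLittlewood.Theorems.GreenTaoLevelTwoGITwoCyclicInverseSeparation

/-!
# Route `GreenTaoLevelTwo`, crux `GITwo` (stmt-Parity-21275), line `birth`, stub `stub_cyclicInverse`: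
# GT08a arXiv Lemma 44 — a large slice `Γ''` of the frequency graph with `4Γ'' − 4Γ''` a graph

Fifteenth helper file toward the XL stub `stub_cyclicInverse` (B. Green, T. Tao, arXiv:math/0503014,
Thm. 68 = PEMS 51 (2008) Thm. 12.8).  It assembles **arXiv Lemma 44** over `ℤ/Nℤ` (`N` prime) from
the landed ingredients: the small vertical fibre (`…GraphFibre` + Plünnecke–Ruzsa `…Affine`), the
separating set (`…Separation`, qualitative: `#S ≤ #A`), one large torus box (`…TorusBoxes`) and the
deduction (`…GraphSlice`):

* `exists_slice_four_sub_four_graph` — if `Γ' ⊆ ℤ/Nℤ × ℤ/Nℤ` is a nonempty graph with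
  `#(Γ' − Γ') ≤ K #Γ'` (`K ≥ 0`), then for some `d ≤ K¹⁷` there is `Γ'' ⊆ Γ'` with
  `#Γ'' ≥ #Γ' / 128^d` such that `4Γ'' − 4Γ''` is a graph (first projection injective).

The printed lemma has `|Γ''| ≥ 2⁻⁶K⁻¹³N` thanks to the logarithmic separation lemma; the present
`128^{-K¹⁷}` is weaker but still a constant depending only on `K = K(η)`, which is all the registered
stub (constants depending on `η` and `d`) requires.  Next (not here): arXiv Prop. 43 — Bogolyubov
(`…Bogolyubov`) on `H'' = pr₁ Γ''` and the locally linear map `M` on `B(S', ¼) ⊆ 2H'' − 2H''`.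

References: [GreenTao2008U3Inverse] arXiv:math/0503014, Lemma 44.
-/

namespace Summit.Parity.GeneralizedHardyLittlewood.GreenTaoLevelTwoGITwoCyclicInverse

open Finset
open scoped Pointwise

variable {N : ℕ} [NeZero N]

/-- **GT08a arXiv Lemma 44 (qualitative form) over `ℤ/Nℤ`, `N` prime.** A nonempty graph
`Γ' ⊆ ℤ/Nℤ × ℤ/Nℤ` with `#(Γ' − Γ') ≤ K · #Γ'` contains, for some `d ≤ K¹⁷`, a slice `Γ''` with
`#Γ'' ≥ #Γ'/128^d` such that `4Γ'' − 4Γ''` is a graph. [cite: GreenTao2008U3Inverse, Lemma 44] -/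
theorem exists_slice_four_sub_four_graph (hN : N.Prime) (Γ' : Finset (ZMod N × ZMod N))
    (hne : Γ'.Nonempty) (hgraph : Set.InjOn Prod.fst (Γ' : Set (ZMod N × ZMod N))) {K : ℝ}
    (hK : (#(Γ' - Γ') : ℝ) ≤ K * #Γ') :
    ∃ (d : ℕ) (Γ'' : Finset (ZMod N × ZMod N)), (d : ℝ) ≤ K ^ 17 ∧ Γ'' ⊆ Γ' ∧
      (#Γ' : ℝ) / (128 : ℝ) ^ d ≤ #Γ'' ∧
      Set.InjOn Prod.fst ((4 • Γ'' - 4 • Γ'' : Finset (ZMod N × ZMod N)) : Set (ZMod N × ZMod N)) := by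
  classical
  -- the vertical fibre `A` of `8Γ' − 8Γ'` over `0` and its size
  set A : Finset (ZMod N) := ((8 • Γ' - 8 • Γ').filter fun p => p.1 = 0).image Prod.snd with hA
  have hPl : (#(9 • Γ' - 8 • Γ') : ℝ) ≤ K ^ (9 + 8) * #Γ' := card_nsmul_sub_nsmul_le Γ' hne hK 9 8
  have hAcard : (#A : ℝ) ≤ K ^ 17 := card_vertFibre_le Γ' hne hgraph hPl
  -- a separating set
  obtain ⟨S, hScard, hSsep⟩ := exists_separating_set' hN A
  -- one large box of side `1/128` for the frequencies of `Γ'`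
  obtain ⟨Γ'', hsub, hcard, hbox⟩ :=
    exists_large_box_fiber Γ' (Prod.snd : ZMod N × ZMod N → ZMod N) S (L := 128) (by norm_num)
  refine ⟨#S, Γ'', ?_, hsub, ?_, ?_⟩
  · calc ((#S : ℕ) : ℝ) ≤ #A := by exact_mod_cast hScard
      _ ≤ K ^ 17 := hAcard
  · simpa using hcard
  -- the deduction; `Γ''` is nonempty because `Γ'` is
  have hne'' : Γ''.Nonempty := by
    rw [← card_pos, ← Nat.cast_pos (α := ℝ)]
    have hpos : (0 : ℝ) < #Γ' / ((128 : ℕ) : ℝ) ^ #S := by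
      have h1 : (0 : ℝ) < #Γ' := by exact_mod_cast hne.card_pos
      exact div_pos h1 (pow_pos (by norm_num) _)
    exact lt_of_lt_of_le hpos hcard
  obtain ⟨q₀, hq₀⟩ := hne''
  have hsep : ∀ ξ : ZMod N, ((0 : ZMod N), ξ) ∈ 8 • Γ' - 8 • Γ' →
      (∀ s ∈ S, ‖ZMod.toAddCircle (ξ * s)‖ < 1 / 4) → ξ = 0 := by
    intro ξ hξ hsmall
    have hξA : ξ ∈ A := by
      rw [hA, mem_image]
      exact ⟨((0 : ZMod N), ξ), mem_filter.mpr ⟨hξ, rfl⟩, rfl⟩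
    exact hSsep ξ hξA hsmall
  refine injOn_fst_four_sub_four Γ' Γ'' hsub S hsep (fun s => ZMod.toAddCircle (q₀.2 * s))
    (δ := 1 / 128) (by norm_num) fun p hp s hs => ?_
  exact (hbox p hp q₀ hq₀ s hs).le

end Summit.Parity.GeneralizedHardyLittlewood.GreenTaoLevelTwoGITwoCyclicInverse
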